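import Literature.Topology.FourManifolds.TrisectionsTopFaceFunction
import HarnessLib

/-!
# The Morse function of the top face over the chart zones: no critical points off the rim axis

Topic `Literature/Topology/FourManifolds`; step G (part c-2) of a Morse-theoretic construction
of Gay–Kirby's trisection for the fact seat
`provefact-Literature.Topology.FourManifolds.exists_isBalancedGKTrisection` (Gay–Kirby 2016,
Thm. 4 via §4, Lemma 14).  Everything in this file is **proved**; the definitions (two explicit
curves) are explicit.

On the chart zone `{A_j < a_R}` of a `2`-handle the regular zero set `N` of the gap function is
the product `{B_j = β₀}` of the core disc with the belt circle (`B_eq_of_mem_zone_of_gapFn_eq_zero`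
and its converse `gapFn_eq_zero_of_B_eq`: there `T = T_P(A_j B_j)` is affine), on which the
top-face function is `Φ = c₀(1 - ε x₀² ρ(A) + (κβ₀/η) A) + ε₄ χ_b(A) y₂`.  Two explicit curves
in `N` — scaling the core coordinates, `x ↦ eᵗ x` (`scaleCurve`), and rotating the belt
coordinates (`rotCurve`) — have nonzero derivative of `Φ` along them at every point of the zone
off the two rim points `{x = 0, y₃ = 0}` (under the sign conditions of the design), so **`Φ_N`
has no critical point on the zone part of `N` except possibly at the rim points**
(`not_isMCriticalPt_phiN_zone_of_A_pos`, `not_isMCriticalPt_phiN_zone_of_y3_ne_zero`; the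
criterion `not_isMCriticalPt_of_hasDerivAt_comp₃`: a function with nonzero derivative along a
smooth curve is not critical).

## References

* D. Gay, R. Kirby, *Trisecting 4-manifolds*, Geom. Topol. 20 (2016), §4, Lemma 14. [GayKirby2016]
* J. Milnor, *Morse theory* (1963), §2. [Milnor1963]
-/

open scoped Manifold ContDiff Topology
open Set Function Filter

noncomputable section

universe u

namespace Literature.Topology.FourManifolds

open Flow

/-- Local notation: `𝔼 n` is the model Euclidean space `EuclideanSpace ℝ (Fin n)`. -/
local notation "𝔼 " n:arg => EuclideanSpace ℝ (Fin n)

/-! ### A function with nonzero derivative along a smooth curve is not critical -/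

section Curve

variable {N : Type*} [TopologicalSpace N] [ChartedSpace (𝔼 3) N]

/-- **Criterion**: if `Φ ∘ c` has nonzero derivative at `0` for a curve `c` differentiable at
`0`, then `Φ` is not critical at `c 0`. [cite: Milnor1963, §2] -/
theorem not_isMCriticalPt_of_hasDerivAt_comp₃ {Φ : N → ℝ} {c : ℝ → N} {d : ℝ}
    (hc : MDifferentiableAt 𝓘(ℝ, ℝ) (𝓡 3) c 0) (hΦ : MDifferentiableAt (𝓡 3) 𝓘(ℝ, ℝ) Φ (c 0))
    (hd : HasDerivAt (Φ ∘ c) d 0) (hd0 : d ≠ 0) : ¬ IsMCriticalPt (𝓡 3) Φ (c 0) := by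
  intro hcrit
  have h1 : HasMFDerivAt 𝓘(ℝ, ℝ) 𝓘(ℝ, ℝ) (Φ ∘ c) 0
      ((mfderiv (𝓡 3) 𝓘(ℝ, ℝ) Φ (c 0)).comp (mfderiv 𝓘(ℝ, ℝ) (𝓡 3) c 0)) :=
    hΦ.hasMFDerivAt.comp 0 hc.hasMFDerivAt
  have hc0 : mfderiv (𝓡 3) 𝓘(ℝ, ℝ) Φ (c 0) = 0 := hcrit
  rw [hc0, ContinuousLinearMap.zero_comp] at h1
  have h2 : HasFDerivAt (Φ ∘ c) (0 : ℝ →L[ℝ] ℝ) 0 := hasMFDerivAt_iff_hasFDerivAt.1 h1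
  have h3 : HasDerivAt (Φ ∘ c) 0 0 := by
    have := h2.hasDerivAt
    simpa using this
  exact hd0 (hd.unique h3)

end Curve

variable {X : Type u} [TopologicalSpace X] [T2Space X] [CompactSpace X] [ChartedSpace (𝔼 4) X]
  [IsManifold (𝓡 4) ∞ X]

/-! ### Points of the box chart from coordinates -/

namespace MilnorBox

variable {f : X → ℝ} {ξ : Π x : X, TangentSpace (𝓡 4) x} {c : X} (D : MilnorBox (𝓡 4) f ξ c)

omit [T2Space X] [CompactSpace X] [IsManifold (𝓡 4) ∞ X] in
/-- A vector of norm `≤ 3ε` gives a point of the chart target. [cite: MilnorHCobordism1965, Def. 3.1] -/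
theorem chart_add_mem_target {v : 𝔼 4} (hv : ‖v‖ ≤ 3 * D.ε) : D.chart c + v ∈ D.chart.target := by
  have h1 : D.chart.extend (𝓡 4) c + v ∈ (D.chart.extend (𝓡 4)).target := by
    apply D.closedBall_subset
    rw [Metric.mem_closedBall, dist_eq_norm, add_sub_cancel_left]
    exact hv
  simpa [OpenPartialHomeomorph.extend_target] using h1

omit [T2Space X] [CompactSpace X] [IsManifold (𝓡 4) ∞ X] in
/-- The point of the chart with coordinates `v`. [folklore] -/
theorem chart_symm_add_mem_source {v : 𝔼 4} (hv : ‖v‖ ≤ 3 * D.ε) : D.chart.symm (D.chart c + v) ∈ D.chart.source :=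
  D.chart.map_target (D.chart_add_mem_target hv)

omit [T2Space X] [CompactSpace X] [IsManifold (𝓡 4) ∞ X] in
/-- Its coordinates are `v`. [folklore] -/
theorem coord_chart_symm_add {v : 𝔼 4} (hv : ‖v‖ ≤ 3 * D.ε) : D.coord (D.chart.symm (D.chart c + v)) = v := by
  rw [D.coord_symm_eq (D.chart_add_mem_target hv), add_sub_cancel_left]

omit [T2Space X] [CompactSpace X] [IsManifold (𝓡 4) ∞ X] in
/-- The map `v ↦ chart⁻¹(chart c + v)` is smooth on the open ball of radius `3ε`. [folklore] -/
theorem contMDiffAt_chart_symm_add {v : 𝔼 4} (hv : ‖v‖ < 3 * D.ε) :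
    ContMDiffAt 𝓘(ℝ, 𝔼 4) (𝓡 4) ∞ (fun w => D.chart.symm (D.chart c + w)) v := by
  have h1 : ContMDiffAt (𝓡 4) (𝓡 4) ∞ D.chart.symm (D.chart c + v) :=
    (contMDiffOn_symm_of_mem_maximalAtlas D.mem_maximalAtlas).contMDiffAt
      (D.chart.open_target.mem_nhds (D.chart_add_mem_target hv.le))
  exact h1.comp v (contMDiffAt_const.add contMDiffAt_id)

end MilnorBox

namespace HandleBoxes

variable {f : X → ℝ} {ξ : Π x : X, TangentSpace (𝓡 4) x} {a η : ℝ} {ι : Type} [Fintype ι]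
  (H : HandleBoxes f ξ a η ι)
  {hξ : ContMDiff (𝓡 4) (𝓡 4).tangent ∞ fun x => (⟨x, ξ x⟩ : TangentBundle (𝓡 4) X)}
  {h : IsRegularLevel (𝓡 4) f a} {φ : RegularLevel h → ℝ} {h₂ TP χlo χhi ρ χb : ℝ → ℝ}
  {Spl Sbot Smin Psw c₀ ε κ aR ε₄ β₀ P₁ : ℝ}

omit [T2Space X] [CompactSpace X] [IsManifold (𝓡 4) ∞ X] [Fintype ι] in
/-- `A_j = u₀² + u₁²` in coordinates. [folklore] -/
theorem A_eq_coord (j : ι) (z : X) : H.A j z = (H.box j).coord z 0 ^ 2 + (H.box j).coord z 1 ^ 2 := by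
  rw [A_eq_nsq, TubeModel.nsq_apply]; rfl

omit [T2Space X] [CompactSpace X] [IsManifold (𝓡 4) ∞ X] [Fintype ι] in
/-- `B_j = u₂² + u₃²` in coordinates. [folklore] -/
theorem B_eq_coord (j : ι) (z : X) : H.B j z = (H.box j).coord z 2 ^ 2 + (H.box j).coord z 3 ^ 2 := by
  rw [B_eq_bsq, RadialThickening.bsq_apply]

omit [T2Space X] [CompactSpace X] [IsManifold (𝓡 4) ∞ X] [Fintype ι] in
/-- The coordinates of a point with small `A_j, B_j` have small norm: `‖u‖² = A_j + B_j`. [folklore] -/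
theorem norm_coord_sq (j : ι) (z : X) : ‖(H.box j).coord z‖ ^ 2 = H.A j z + H.B j z := by
  rw [EuclideanSpace.norm_sq_eq, H.A_eq_coord, H.B_eq_coord, Fin.sum_univ_four]
  simp only [Real.norm_eq_abs, sq_abs]
  ring

/-! ### The zero set of the gap function on a chart zone -/

/-- **On the zone part of `N`, `B_j = β₀`** (and `T = η + β₀ - A_j`): a point of
`source_j` in the band and the plateau with `A_j < a_R`, `P_j ≤ P₁` (affine range of `T_P`)
and `γ = 0`. [cite: GayKirby2016, §4, Lemma 14] -/
theorem B_eq_of_gapFn_eq_zero (hgl : IsGradientLike (𝓡 4) f ξ) (hfM : IsMorse (𝓡 4) f)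
    {v₁ : ℝ} (hPsw : 2 * Psw ≤ η ^ 2) (hP₁ : 2 * P₁ < Psw)
    (hTP₂ : ∀ P, 2 * P₁ ≤ P → TP P = Spl) (hh₂v : ∀ t ≤ v₁, h₂ t = Spl)
    (hφv : ∀ j (y : RegularLevel h), y.1 ∈ (H.box j).chart.source → H.P j y.1 < 2 * Psw → φ y ≤ v₁)
    (hTP₁ : ∀ P, P ≤ P₁ → TP P = η + β₀ - P / β₀) (hβ₀ : 0 < β₀)
    {j : ι} {z : X} (hz : z ∈ (H.box j).chart.source) (hPz : H.P j z ≤ P₁)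
    (hf₁ : a - η < f z) (hf₂ : f z < a + 2 * η) (hlo : χlo (f z - a) = 1) (hhi : χhi (f z - a) = 1)
    (hγ : H.gapFn hξ h φ h₂ TP χlo χhi Spl Sbot Smin Psw z = 0) :
    H.B j z = β₀ ∧ H.topHeightBot hξ h φ h₂ TP χlo χhi Spl Sbot Smin Psw z = η + β₀ - H.A j z := by
  have hPsw0 : 0 < Psw := by nlinarith [hP₁, show 0 ≤ P₁ from le_trans (H.P_nonneg j z) hPz]
  have hT : H.topHeightBot hξ h φ h₂ TP χlo χhi Spl Sbot Smin Psw z = η + β₀ - H.P j z / β₀ := by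
    rw [H.topHeightBot_eq_TP hgl hfM hPsw hP₁ hTP₂ hh₂v hφv hz (by linarith) hf₁ hf₂ hlo hhi, hTP₁ _ hPz]
  have hs : f z - a = H.topHeightBot hξ h φ h₂ TP χlo χhi Spl Sbot Smin Psw z := by
    rw [gapFn_apply] at hγ; linarith
  rw [hT, H.apply_eq hz, P_def] at hs
  have hA := H.A_nonneg j z
  have hkey : (H.B j z - β₀) * (β₀ + H.A j z) = 0 := by
    field_simp at hs
    nlinarith [hs]
  have hB : H.B j z = β₀ := by
    rcases mul_eq_zero.1 hkey with h1 | h1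
    · linarith
    · linarith
  refine ⟨hB, ?_⟩
  rw [hT, P_def, hB]
  field_simp

/-- **Conversely, a point of the zone with `B_j = β₀` lies on `N`**, and there
`Θ = c₀ 𝒯̂(coord)`, `β = χ_b(A_j) y₂`, `f = a + η + β₀ - A_j`. [cite: GayKirby2016, §4, Lemma 14] -/
theorem gapFn_eq_zero_of_B_eq (hgl : IsGradientLike (𝓡 4) f ξ) (hfM : IsMorse (𝓡 4) f)
    {v₁ : ℝ} (hPsw : 2 * Psw ≤ η ^ 2) (hP₁ : 2 * P₁ < Psw)
    (hTP₂ : ∀ P, 2 * P₁ ≤ P → TP P = Spl) (hh₂v : ∀ t ≤ v₁, h₂ t = Spl)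
    (hφv : ∀ j (y : RegularLevel h), y.1 ∈ (H.box j).chart.source → H.P j y.1 < 2 * Psw → φ y ≤ v₁)
    (hTP₁ : ∀ P, P ≤ P₁ → TP P = η + β₀ - P / β₀) (hβ₀ : 0 < β₀) (hβ₀η : β₀ < η)
    (haRP : aR * β₀ ≤ P₁) (haR : aR < η)
    (hplateau : ∀ s, -η / 2 < s → s ≤ η + β₀ → χlo s = 1 ∧ χhi s = 1)
    {j : ι} {w : X} (hw : w ∈ (H.box j).chart.source) (hA : H.A j w < aR) (hB : H.B j w = β₀) :
    H.gapFn hξ h φ h₂ TP χlo χhi Spl Sbot Smin Psw w = 0 ∧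
      f w = a + η + β₀ - H.A j w ∧
      H.theta hξ h φ ρ c₀ ε κ aR w = c₀ * TubeModel.tubeHat ε κ η ρ ((H.box j).coord w) ∧
      H.beltTerm χb w = χb (H.A j w) * (H.box j).coord w 2 := by
  have hη := H.eta_pos
  have hA0 := H.A_nonneg j w
  have hfw : f w = a + η + β₀ - H.A j w := by rw [H.apply_eq hw, hB]; ring
  have hPw : H.P j w ≤ P₁ := by
    rw [P_def, hB]; nlinarith
  have hPsw0 : 0 < Psw := by nlinarith
  have hf₁ : a - η < f w := by linarith
  have hf₂ : f w < a + 2 * η := by linarith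
  obtain ⟨hlo, hhi⟩ := hplateau (f w - a) (by linarith) (by linarith)
  have hT : H.topHeightBot hξ h φ h₂ TP χlo χhi Spl Sbot Smin Psw w = η + β₀ - H.A j w := by
    rw [H.topHeightBot_eq_TP hgl hfM hPsw hP₁ hTP₂ hh₂v hφv hw (by linarith) hf₁ hf₂ hlo hhi, hTP₁ _ hPw, P_def, hB]
    field_simp
  refine ⟨by rw [gapFn_apply, hT, hfw]; ring, hfw, H.theta_of_mem_zone ⟨hw, hA⟩, ?_⟩
  rw [H.beltTerm_of_mem_source hw]; rfl

/-! ### The two curves -/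

/-- The coordinate vector `(a₀, a₁, a₂, a₃)`. [folklore] -/
def vec4 (a₀ a₁ a₂ a₃ : ℝ) : 𝔼 4 := WithLp.toLp 2 ![a₀, a₁, a₂, a₃]

omit [T2Space X] [CompactSpace X] [IsManifold (𝓡 4) ∞ X] [Fintype ι] in
/-- The entry `a₀` of `vec4 a₀ a₁ a₂ a₃`. [folklore] -/
@[simp] theorem vec4_apply_zero (a₀ a₁ a₂ a₃ : ℝ) : vec4 a₀ a₁ a₂ a₃ 0 = a₀ := rfl
omit [T2Space X] [CompactSpace X] [IsManifold (𝓡 4) ∞ X] [Fintype ι] in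
/-- The entry `a₁` of `vec4 a₀ a₁ a₂ a₃`. [folklore] -/
@[simp] theorem vec4_apply_one (a₀ a₁ a₂ a₃ : ℝ) : vec4 a₀ a₁ a₂ a₃ 1 = a₁ := rfl
omit [T2Space X] [CompactSpace X] [IsManifold (𝓡 4) ∞ X] [Fintype ι] in
/-- The entry `a₂` of `vec4 a₀ a₁ a₂ a₃`. [folklore] -/
@[simp] theorem vec4_apply_two (a₀ a₁ a₂ a₃ : ℝ) : vec4 a₀ a₁ a₂ a₃ 2 = a₂ := rfl
omit [T2Space X] [CompactSpace X] [IsManifold (𝓡 4) ∞ X] [Fintype ι] in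
/-- The entry `a₃` of `vec4 a₀ a₁ a₂ a₃`. [folklore] -/
@[simp] theorem vec4_apply_three (a₀ a₁ a₂ a₃ : ℝ) : vec4 a₀ a₁ a₂ a₃ 3 = a₃ := rfl

omit [T2Space X] [CompactSpace X] [IsManifold (𝓡 4) ∞ X] [Fintype ι] in
/-- `vec4` is smooth in its entries. [folklore] -/
theorem contDiff_vec4 {g₀ g₁ g₂ g₃ : ℝ → ℝ} (h₀ : ContDiff ℝ ∞ g₀) (h₁ : ContDiff ℝ ∞ g₁) (h₂ : ContDiff ℝ ∞ g₂)
    (h₃ : ContDiff ℝ ∞ g₃) : ContDiff ℝ ∞ fun t => vec4 (g₀ t) (g₁ t) (g₂ t) (g₃ t) := by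
  rw [contDiff_piLp]
  intro i
  fin_cases i
  · exact h₀
  · exact h₁
  · exact h₂
  · exact h₃

omit [T2Space X] [CompactSpace X] [IsManifold (𝓡 4) ∞ X] [Fintype ι] in
/-- Norm of `vec4`. [folklore] -/
theorem norm_vec4_sq (a₀ a₁ a₂ a₃ : ℝ) : ‖vec4 a₀ a₁ a₂ a₃‖ ^ 2 = a₀ ^ 2 + a₁ ^ 2 + a₂ ^ 2 + a₃ ^ 2 := by
  rw [EuclideanSpace.norm_sq_eq, Fin.sum_univ_four]
  simp [Real.norm_eq_abs, sq_abs]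

/-- **The scaling curve** through `z` in `source_j`: `t ↦ chart⁻¹(chart c_j + (eᵗu₀, eᵗu₁, u₂, u₃))`. [folklore] -/
def scaleCurve (j : ι) (z : X) (t : ℝ) : X :=
  (H.box j).chart.symm ((H.box j).chart (H.cpt j) +
    vec4 (Real.exp t * (H.box j).coord z 0) (Real.exp t * (H.box j).coord z 1) ((H.box j).coord z 2) ((H.box j).coord z 3))

/-- **The rotation curve** through `z` in `source_j`: rotate `(u₂, u₃)` by the angle `t`. [folklore] -/
def rotCurve (j : ι) (z : X) (t : ℝ) : X :=
  (H.box j).chart.symm ((H.box j).chart (H.cpt j) +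
    vec4 ((H.box j).coord z 0) ((H.box j).coord z 1)
      (Real.cos t * (H.box j).coord z 2 - Real.sin t * (H.box j).coord z 3)
      (Real.sin t * (H.box j).coord z 2 + Real.cos t * (H.box j).coord z 3))

omit [T2Space X] [CompactSpace X] [IsManifold (𝓡 4) ∞ X] [Fintype ι] in
/-- Coordinates with `u₀² + u₁² + u₂² + u₃² < 3η` have norm `< 3 ε_box` (`3η < ε_box²`). [folklore] -/
theorem norm_lt_of_sq_lt (j : ι) {v : 𝔼 4} (hv : v 0 ^ 2 + v 1 ^ 2 + v 2 ^ 2 + v 3 ^ 2 < 3 * η) :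
    ‖v‖ < 3 * (H.box j).ε := by
  have hε := (H.box j).eps_pos
  have h1 : ‖v‖ ^ 2 < (3 * (H.box j).ε) ^ 2 := by
    rw [EuclideanSpace.norm_sq_eq, Fin.sum_univ_four]
    simp only [Real.norm_eq_abs, sq_abs]
    have := H.eta_lt j
    nlinarith
  exact lt_of_pow_lt_pow_left₀ 2 (by positivity) h1

omit [T2Space X] [CompactSpace X] [IsManifold (𝓡 4) ∞ X] [Fintype ι] in
/-- **The scaling curve near `t = 0`**: for `z ∈ source_j` with `2A_j + B_j < 3η`, the curve
stays in `source_j` with coordinates `(eᵗu₀, eᵗu₁, u₂, u₃)`, `A_j = e²ᵗ A_j(z)`, `B_j = B_j(z)`. [folklore] -/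
theorem scaleCurve_eventually {j : ι} {z : X} (hsmall : 2 * H.A j z + H.B j z < 3 * η) :
    ∀ᶠ t in 𝓝 (0 : ℝ), H.scaleCurve j z t ∈ (H.box j).chart.source ∧
      (H.box j).coord (H.scaleCurve j z t) =
        vec4 (Real.exp t * (H.box j).coord z 0) (Real.exp t * (H.box j).coord z 1) ((H.box j).coord z 2) ((H.box j).coord z 3) ∧
      H.A j (H.scaleCurve j z t) = Real.exp t ^ 2 * H.A j z ∧ H.B j (H.scaleCurve j z t) = H.B j z := by
  have hA := H.A_eq_coord j z
  have hB := H.B_eq_coord j z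
  have hA0 := H.A_nonneg j z
  -- `e^{2t} < 2` near `0`
  have hexp : ∀ᶠ t in 𝓝 (0 : ℝ), Real.exp t ^ 2 < 2 := by
    have hc : ContinuousAt (fun t => Real.exp t ^ 2) 0 := (Real.continuous_exp.pow 2).continuousAt
    have : (fun t => Real.exp t ^ 2) 0 < 2 := by simp
    exact hc.eventually (Iio_mem_nhds this)
  filter_upwards [hexp] with t ht
  set v := vec4 (Real.exp t * (H.box j).coord z 0) (Real.exp t * (H.box j).coord z 1) ((H.box j).coord z 2)
    ((H.box j).coord z 3) with hv
  have hvn : ‖v‖ < 3 * (H.box j).ε := by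
    apply H.norm_lt_of_sq_lt j
    simp only [hv, vec4_apply_zero, vec4_apply_one, vec4_apply_two, vec4_apply_three]
    have h1 : (Real.exp t * (H.box j).coord z 0) ^ 2 + (Real.exp t * (H.box j).coord z 1) ^ 2 =
        Real.exp t ^ 2 * H.A j z := by rw [hA]; ring
    nlinarith [h1, hB, sq_nonneg ((H.box j).coord z 2), sq_nonneg ((H.box j).coord z 3)]
  have hsrc : H.scaleCurve j z t ∈ (H.box j).chart.source := (H.box j).chart_symm_add_mem_source hvn.le
  have hcoord : (H.box j).coord (H.scaleCurve j z t) = v := (H.box j).coord_chart_symm_add hvn.le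
  refine ⟨hsrc, hcoord, ?_, ?_⟩
  · rw [H.A_eq_coord, hcoord, hA]; simp [hv]; ring
  · rw [H.B_eq_coord, hcoord, hB]; simp [hv]

omit [T2Space X] [CompactSpace X] [IsManifold (𝓡 4) ∞ X] [Fintype ι] in
/-- **The rotation curve near `t = 0`** (in fact for all `t`): for `z ∈ source_j` with
`A_j + B_j < 3η`, the curve stays in `source_j` with the rotated coordinates,
`A_j = A_j(z)`, `B_j = B_j(z)`. [folklore] -/
theorem rotCurve_eventually {j : ι} {z : X} (hsmall : H.A j z + H.B j z < 3 * η) :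
    ∀ᶠ t in 𝓝 (0 : ℝ), H.rotCurve j z t ∈ (H.box j).chart.source ∧
      (H.box j).coord (H.rotCurve j z t) =
        vec4 ((H.box j).coord z 0) ((H.box j).coord z 1)
          (Real.cos t * (H.box j).coord z 2 - Real.sin t * (H.box j).coord z 3)
          (Real.sin t * (H.box j).coord z 2 + Real.cos t * (H.box j).coord z 3) ∧
      H.A j (H.rotCurve j z t) = H.A j z ∧ H.B j (H.rotCurve j z t) = H.B j z := by
  have hA := H.A_eq_coord j z
  have hB := H.B_eq_coord j z
  refine Eventually.of_forall fun t => ?_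
  set v := vec4 ((H.box j).coord z 0) ((H.box j).coord z 1)
      (Real.cos t * (H.box j).coord z 2 - Real.sin t * (H.box j).coord z 3)
      (Real.sin t * (H.box j).coord z 2 + Real.cos t * (H.box j).coord z 3) with hv
  have hrot : (Real.cos t * (H.box j).coord z 2 - Real.sin t * (H.box j).coord z 3) ^ 2 +
      (Real.sin t * (H.box j).coord z 2 + Real.cos t * (H.box j).coord z 3) ^ 2 =
        (H.box j).coord z 2 ^ 2 + (H.box j).coord z 3 ^ 2 := by
    have := Real.sin_sq_add_cos_sq t
    nlinarith [this]
  have hvn : ‖v‖ < 3 * (H.box j).ε := by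
    apply H.norm_lt_of_sq_lt j
    simp only [hv, vec4_apply_zero, vec4_apply_one, vec4_apply_two, vec4_apply_three]
    nlinarith [hrot, hA, hB]
  have hsrc : H.rotCurve j z t ∈ (H.box j).chart.source := (H.box j).chart_symm_add_mem_source hvn.le
  have hcoord : (H.box j).coord (H.rotCurve j z t) = v := (H.box j).coord_chart_symm_add hvn.le
  refine ⟨hsrc, hcoord, ?_, ?_⟩
  · rw [H.A_eq_coord, hcoord, hA]; simp [hv]
  · rw [H.B_eq_coord, hcoord, hB]; simp only [hv, vec4_apply_two, vec4_apply_three]; exact hrot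

omit [T2Space X] [CompactSpace X] [IsManifold (𝓡 4) ∞ X] [Fintype ι] in
/-- The scaling curve is smooth near `0` (as a map into `X`). [folklore] -/
theorem contMDiffAt_scaleCurve {j : ι} {z : X} (hsmall : 2 * H.A j z + H.B j z < 3 * η) :
    ContMDiffAt 𝓘(ℝ, ℝ) (𝓡 4) ∞ (H.scaleCurve j z) 0 := by
  have hA := H.A_eq_coord j z
  have hB := H.B_eq_coord j z
  have hvn : ‖vec4 (Real.exp 0 * (H.box j).coord z 0) (Real.exp 0 * (H.box j).coord z 1) ((H.box j).coord z 2)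
      ((H.box j).coord z 3)‖ < 3 * (H.box j).ε := by
    apply H.norm_lt_of_sq_lt j
    simp only [vec4_apply_zero, vec4_apply_one, vec4_apply_two, vec4_apply_three, Real.exp_zero, one_mul]
    nlinarith [hA, hB, H.A_nonneg j z]
  have h1 := (H.box j).contMDiffAt_chart_symm_add hvn
  have h2 : ContMDiff 𝓘(ℝ, ℝ) 𝓘(ℝ, 𝔼 4) ∞ fun t => vec4 (Real.exp t * (H.box j).coord z 0)
      (Real.exp t * (H.box j).coord z 1) ((H.box j).coord z 2) ((H.box j).coord z 3) :=
    (contDiff_vec4 (Real.contDiff_exp.mul contDiff_const) (Real.contDiff_exp.mul contDiff_const) contDiff_const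
      contDiff_const).contMDiff
  have heq : H.scaleCurve j z = (fun w => (H.box j).chart.symm ((H.box j).chart (H.cpt j) + w)) ∘ fun t =>
      vec4 (Real.exp t * (H.box j).coord z 0) (Real.exp t * (H.box j).coord z 1) ((H.box j).coord z 2)
        ((H.box j).coord z 3) := rfl
  rw [heq]
  exact h1.comp 0 h2.contMDiffAt

omit [T2Space X] [CompactSpace X] [IsManifold (𝓡 4) ∞ X] [Fintype ι] in
/-- The rotation curve is smooth (as a map into `X`). [folklore] -/
theorem contMDiffAt_rotCurve {j : ι} {z : X} (hsmall : H.A j z + H.B j z < 3 * η) :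
    ContMDiffAt 𝓘(ℝ, ℝ) (𝓡 4) ∞ (H.rotCurve j z) 0 := by
  have hA := H.A_eq_coord j z
  have hB := H.B_eq_coord j z
  have hvn : ‖vec4 ((H.box j).coord z 0) ((H.box j).coord z 1)
      (Real.cos 0 * (H.box j).coord z 2 - Real.sin 0 * (H.box j).coord z 3)
      (Real.sin 0 * (H.box j).coord z 2 + Real.cos 0 * (H.box j).coord z 3)‖ < 3 * (H.box j).ε := by
    apply H.norm_lt_of_sq_lt j
    simp only [vec4_apply_zero, vec4_apply_one, vec4_apply_two, vec4_apply_three, Real.cos_zero, Real.sin_zero,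
      one_mul, zero_mul, sub_zero, zero_add]
    nlinarith [hA, hB]
  have h1 := (H.box j).contMDiffAt_chart_symm_add hvn
  have h2 : ContMDiff 𝓘(ℝ, ℝ) 𝓘(ℝ, 𝔼 4) ∞ fun t => vec4 ((H.box j).coord z 0) ((H.box j).coord z 1)
      (Real.cos t * (H.box j).coord z 2 - Real.sin t * (H.box j).coord z 3)
      (Real.sin t * (H.box j).coord z 2 + Real.cos t * (H.box j).coord z 3) :=
    (contDiff_vec4 contDiff_const contDiff_const
      ((Real.contDiff_cos.mul contDiff_const).sub (Real.contDiff_sin.mul contDiff_const))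
      ((Real.contDiff_sin.mul contDiff_const).add (Real.contDiff_cos.mul contDiff_const))).contMDiff
  have heq : H.rotCurve j z = (fun w => (H.box j).chart.symm ((H.box j).chart (H.cpt j) + w)) ∘ fun t =>
      vec4 ((H.box j).coord z 0) ((H.box j).coord z 1)
        (Real.cos t * (H.box j).coord z 2 - Real.sin t * (H.box j).coord z 3)
        (Real.sin t * (H.box j).coord z 2 + Real.cos t * (H.box j).coord z 3) := rfl
  have h20 := h2.contMDiffAt (x := (0 : ℝ))
  rw [heq]
  refine ContMDiffAt.comp (0 : ℝ) ?_ h20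
  simpa using h1

omit [T2Space X] [CompactSpace X] [IsManifold (𝓡 4) ∞ X] [Fintype ι] in
/-- `vec4` of the entries of a vector is the vector. [folklore] -/
theorem vec4_eta (u : 𝔼 4) : vec4 (u 0) (u 1) (u 2) (u 3) = u := by
  ext i; fin_cases i <;> rfl

omit [T2Space X] [CompactSpace X] [IsManifold (𝓡 4) ∞ X] [Fintype ι] in
/-- The scaling curve starts at `z`. [folklore] -/
theorem scaleCurve_zero {j : ι} {z : X} (hz : z ∈ (H.box j).chart.source) : H.scaleCurve j z 0 = z := by
  rw [scaleCurve, Real.exp_zero, one_mul, one_mul, vec4_eta, MilnorBox.coord_eq, add_sub_cancel,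
    (H.box j).chart.left_inv hz]

omit [T2Space X] [CompactSpace X] [IsManifold (𝓡 4) ∞ X] [Fintype ι] in
/-- The rotation curve starts at `z`. [folklore] -/
theorem rotCurve_zero {j : ι} {z : X} (hz : z ∈ (H.box j).chart.source) : H.rotCurve j z 0 = z := by
  rw [rotCurve, Real.cos_zero, Real.sin_zero, one_mul, zero_mul, sub_zero, zero_mul, one_mul, zero_add, vec4_eta,
    MilnorBox.coord_eq, add_sub_cancel, (H.box j).chart.left_inv hz]

/-- A curve in `X` which stays on `N = γ⁻¹(0)` near `0` lifts to a curve in `N`, smooth at `0`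
if the curve is. [folklore] -/
theorem contMDiffAt_liftCurve (hγ : IsRegularLevel (𝓡 4) (H.gapFn hξ h φ h₂ TP χlo χhi Spl Sbot Smin Psw) 0)
    {C : ℝ → X} (z : RegularLevel hγ) (hC : ContMDiffAt 𝓘(ℝ, ℝ) (𝓡 4) ∞ C 0)
    (hev : ∀ᶠ t in 𝓝 (0 : ℝ), H.gapFn hξ h φ h₂ TP χlo χhi Spl Sbot Smin Psw (C t) = 0) :
    letI c : ℝ → RegularLevel hγ := fun t =>
      if ht : H.gapFn hξ h φ h₂ TP χlo χhi Spl Sbot Smin Psw (C t) = 0 then ⟨C t, ht⟩ else z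
    ContMDiffAt 𝓘(ℝ, ℝ) (𝓡 3) ∞ c 0 ∧ (RegularLevel.incl hγ ∘ c) =ᶠ[𝓝 0] C := by
  set c : ℝ → RegularLevel hγ := fun t =>
    if ht : H.gapFn hξ h φ h₂ TP χlo χhi Spl Sbot Smin Psw (C t) = 0 then ⟨C t, ht⟩ else z with hcdef
  have hι := RegularLevel.isSmoothEmbedding_incl hγ
  have hevc : (RegularLevel.incl hγ ∘ c) =ᶠ[𝓝 0] C := by
    filter_upwards [hev] with t ht
    simp only [comp_apply, hcdef, dif_pos ht]
  have hcomp : ContMDiffAt 𝓘(ℝ, ℝ) (𝓡 4) ∞ (RegularLevel.incl hγ ∘ c) 0 := hC.congr_of_eventuallyEq hevc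
  have hcont : ContinuousAt c 0 := by
    rw [hι.isEmbedding.isInducing.continuousAt_iff]
    exact hcomp.continuousAt
  exact ⟨(ContMDiffAt.iff_comp_isImmersionAt (hι.isImmersion.isImmersionAt _)).2 ⟨hcont, hcomp⟩, hevc⟩

/-- **`Φ = Θ + ε₄β` is smooth at the points of a chart zone** (there `Θ = c₀𝒯̂_j` and
`β = χ_b(A_j) y₂`). [cite: GayKirby2016, §4, Lemma 14] -/
theorem contMDiffAt_phiN_zone (hρs : ContDiff ℝ ∞ ρ) (hχs : ContDiff ℝ ∞ χb) {j : ι} {z : X} (hz : z ∈ H.zone aR j) :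
    ContMDiffAt (𝓡 4) 𝓘(ℝ, ℝ) ∞ (H.phiN hξ h φ ρ χb c₀ ε κ aR ε₄) z := by
  have hθ : ContMDiffAt (𝓡 4) 𝓘(ℝ, ℝ) ∞ (H.theta hξ h φ ρ c₀ ε κ aR) z := by
    have hev2 : H.theta hξ h φ ρ c₀ ε κ aR =ᶠ[𝓝 z] fun w => c₀ * H.tubeHat ε κ ρ j w := by
      filter_upwards [(H.isOpen_zone aR j).mem_nhds hz] with w hw
      exact H.theta_of_mem_zone hw
    exact (contMDiffAt_const.mul (H.contMDiffAt_tubeHat ε κ hρs hz.1)).congr_of_eventuallyEq hev2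
  have hβc : ContMDiffAt (𝓡 4) 𝓘(ℝ, ℝ) ∞ (H.beltTerm χb) z := by
    have hev2 : H.beltTerm χb =ᶠ[𝓝 z] fun w => χb (H.A j w) * H.yTwo j w := by
      filter_upwards [(H.box j).chart.open_source.mem_nhds hz.1] with w hw
      exact H.beltTerm_of_mem_source hw
    exact (((hχs.contMDiff.contMDiffAt).comp z (H.contMDiffAt_A hz.1)).mul (H.contMDiffAt_yTwo hz.1)).congr_of_eventuallyEq hev2
  exact hθ.add (contMDiffAt_const.mul hβc)

/-! ### No critical point on the zone off the rim axis -/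

section Zone

variable (hgl : IsGradientLike (𝓡 4) f ξ) (hfM : IsMorse (𝓡 4) f)
  {v₁ : ℝ} (hPsw : 2 * Psw ≤ η ^ 2) (hP₁ : 2 * P₁ < Psw)
  (hTP₂ : ∀ P, 2 * P₁ ≤ P → TP P = Spl) (hh₂v : ∀ t ≤ v₁, h₂ t = Spl)
  (hφv : ∀ j (y : RegularLevel h), y.1 ∈ (H.box j).chart.source → H.P j y.1 < 2 * Psw → φ y ≤ v₁)
  (hTP₁ : ∀ P, P ≤ P₁ → TP P = η + β₀ - P / β₀) (hβ₀ : 0 < β₀) (hβ₀η : β₀ < η)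
  (haRP : aR * β₀ ≤ P₁) (haR : aR < η)
  (hplateau : ∀ s, -η / 2 < s → s ≤ η + β₀ → χlo s = 1 ∧ χhi s = 1)
include hgl hfM hPsw hP₁ hTP₂ hh₂v hφv hTP₁ hβ₀ hβ₀η haRP haR hplateau

/-- **(Z1) No critical point of `Φ_N` on the zone part of `N` with `A_j > 0`**, when the
derivative of `Φ` along the scaling curve is nonzero there:
`c₀((κβ₀/η)A - ε u₀²(ρ(A) + Aρ'(A))) + ε₄ A χ_b'(A) u₂ ≠ 0`. [cite: GayKirby2016, §4, Lemma 14] -/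
theorem not_isMCriticalPt_phiN_zone_of_A_pos (hρs : ContDiff ℝ ∞ ρ) (hχs : ContDiff ℝ ∞ χb)
    (hγ : IsRegularLevel (𝓡 4) (H.gapFn hξ h φ h₂ TP χlo χhi Spl Sbot Smin Psw) 0)
    {j : ι} (z : RegularLevel hγ) (hz : z.1 ∈ H.zone aR j) (hB : H.B j z.1 = β₀) (hA : 0 < H.A j z.1)
    (hd : c₀ * (κ / η * β₀ * H.A j z.1 - ε * ((H.box j).coord z.1 0) ^ 2 *
        (ρ (H.A j z.1) + H.A j z.1 * deriv ρ (H.A j z.1))) +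
      ε₄ * (H.A j z.1 * deriv χb (H.A j z.1) * (H.box j).coord z.1 2) ≠ 0) :
    ¬ IsMCriticalPt (𝓡 3) (H.phiN hξ h φ ρ χb c₀ ε κ aR ε₄ ∘ RegularLevel.incl hγ) z := by
  have hη := H.eta_pos
  set A := H.A j z.1 with hAdef
  set u0 := (H.box j).coord z.1 0 with hu0
  set u2 := (H.box j).coord z.1 2 with hu2
  have hzA : A < aR := hz.2
  have hsmall : 2 * H.A j z.1 + H.B j z.1 < 3 * η := by rw [hB]; linarith
  -- the curve and its properties near `0`
  have hev := H.scaleCurve_eventually (j := j) hsmall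
  have hexpA : ∀ᶠ t in 𝓝 (0 : ℝ), Real.exp t ^ 2 * A < aR := by
    have hc : ContinuousAt (fun t => Real.exp t ^ 2 * A) 0 := ((Real.continuous_exp.pow 2).mul continuous_const).continuousAt
    have : (fun t => Real.exp t ^ 2 * A) 0 < aR := by simp [hzA]
    exact hc.eventually (Iio_mem_nhds this)
  -- the explicit function along the curve
  set g : ℝ → ℝ := fun t => c₀ * (1 - ε * ((Real.exp t * u0) ^ 2 * ρ (Real.exp t ^ 2 * A)) +
      κ / η * (Real.exp t ^ 2 * A) * β₀) + ε₄ * (χb (Real.exp t ^ 2 * A) * u2) with hg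
  have hevall : ∀ᶠ t in 𝓝 (0 : ℝ), H.gapFn hξ h φ h₂ TP χlo χhi Spl Sbot Smin Psw (H.scaleCurve j z.1 t) = 0 ∧
      H.phiN hξ h φ ρ χb c₀ ε κ aR ε₄ (H.scaleCurve j z.1 t) = g t := by
    filter_upwards [hev, hexpA] with t ⟨hsrc, hcoord, hAt, hBt⟩ hAlt
    have hAt' : H.A j (H.scaleCurve j z.1 t) < aR := by rw [hAt]; exact hAlt
    have hBt' : H.B j (H.scaleCurve j z.1 t) = β₀ := by rw [hBt, hB]
    obtain ⟨hγ0, -, hθ, hβ⟩ := H.gapFn_eq_zero_of_B_eq (hξ := hξ) (h := h) (φ := φ) (h₂ := h₂) (TP := TP) (χlo := χlo)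
      (χhi := χhi) (ρ := ρ) (χb := χb) (Spl := Spl) (Sbot := Sbot) (Smin := Smin) (Psw := Psw) (c₀ := c₀) (ε := ε)
      (κ := κ) (aR := aR) hgl hfM hPsw hP₁ hTP₂ hh₂v hφv hTP₁ hβ₀ hβ₀η haRP haR hplateau hsrc hAt' hBt'
    refine ⟨hγ0, ?_⟩
    have hnsq : TubeModel.nsq (RadialThickening.proj ((H.box j).coord (H.scaleCurve j z.1 t))) = Real.exp t ^ 2 * A := by
      rw [← A_eq_nsq, hAt]
    have hbsq : RadialThickening.bsq ((H.box j).coord (H.scaleCurve j z.1 t)) = β₀ := by rw [← B_eq_bsq, hBt']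
    rw [HandleBoxes.phiN, hθ, hβ, TubeModel.tubeHat_apply, ChartZone.gmod_apply, hnsq, hbsq, RadialThickening.proj_apply_zero,
      hAt, hcoord]
    simp only [vec4_apply_zero, vec4_apply_two, hg, hAdef, hu0, hu2]
  -- the lifted curve
  obtain ⟨hc, -⟩ := H.contMDiffAt_liftCurve hγ z (H.contMDiffAt_scaleCurve hsmall) (hevall.mono fun t ht => ht.1)
  set c : ℝ → RegularLevel hγ := fun t =>
    if ht : H.gapFn hξ h φ h₂ TP χlo χhi Spl Sbot Smin Psw (H.scaleCurve j z.1 t) = 0 then ⟨H.scaleCurve j z.1 t, ht⟩ else z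
    with hcdef
  have hc0 : c 0 = z := by
    have h0 : H.gapFn hξ h φ h₂ TP χlo χhi Spl Sbot Smin Psw (H.scaleCurve j z.1 0) = 0 := by
      rw [H.scaleCurve_zero hz.1]; exact z.2
    apply (RegularLevel.isEmbedding_incl hγ).injective
    show (c 0).1 = z.1
    simp only [hcdef, dif_pos h0]
    exact H.scaleCurve_zero hz.1
  -- the derivative of `g` at `0`
  have hρd : HasDerivAt ρ (deriv ρ A) (Real.exp 0 ^ 2 * A) := by
    rw [Real.exp_zero, one_pow, one_mul]; exact ((hρs.differentiable (by simp)) A).hasDerivAt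
  have hχd : HasDerivAt χb (deriv χb A) (Real.exp 0 ^ 2 * A) := by
    rw [Real.exp_zero, one_pow, one_mul]; exact ((hχs.differentiable (by simp)) A).hasDerivAt
  have hE : HasDerivAt Real.exp (Real.exp 0) 0 := Real.hasDerivAt_exp 0
  have hE2A : HasDerivAt (fun t => Real.exp t ^ 2 * A) (2 * Real.exp 0 ^ 1 * Real.exp 0 * A) 0 := (hE.pow 2).mul_const A
  have hT1 : HasDerivAt (fun t => (Real.exp t * u0) ^ 2 * ρ (Real.exp t ^ 2 * A))
      (2 * (Real.exp 0 * u0) ^ 1 * (Real.exp 0 * u0) * ρ (Real.exp 0 ^ 2 * A) +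
        (Real.exp 0 * u0) ^ 2 * (deriv ρ A * (2 * Real.exp 0 ^ 1 * Real.exp 0 * A))) 0 :=
    ((hE.mul_const u0).pow 2).mul (hρd.comp 0 hE2A)
  have hT2 : HasDerivAt (fun t => χb (Real.exp t ^ 2 * A) * u2) (deriv χb A * (2 * Real.exp 0 ^ 1 * Real.exp 0 * A) * u2) 0 :=
    (hχd.comp 0 hE2A).mul_const u2
  have hgd : HasDerivAt g (c₀ * (-(ε * (2 * (Real.exp 0 * u0) ^ 1 * (Real.exp 0 * u0) * ρ (Real.exp 0 ^ 2 * A) +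
        (Real.exp 0 * u0) ^ 2 * (deriv ρ A * (2 * Real.exp 0 ^ 1 * Real.exp 0 * A)))) +
          κ / η * (2 * Real.exp 0 ^ 1 * Real.exp 0 * A) * β₀) +
      ε₄ * (deriv χb A * (2 * Real.exp 0 ^ 1 * Real.exp 0 * A) * u2)) 0 := by
    exact (((((hasDerivAt_const (0 : ℝ) (1 : ℝ)).sub (hT1.const_mul ε)).add ((hE2A.const_mul (κ / η)).mul_const β₀)).const_mul
      c₀).add (hT2.const_mul ε₄)).congr_deriv (by ring)
  have hgd' : HasDerivAt g (2 * (c₀ * (κ / η * β₀ * A - ε * u0 ^ 2 * (ρ A + A * deriv ρ A)) + ε₄ * (A * deriv χb A * u2))) 0 := by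
    convert hgd using 1
    simp only [Real.exp_zero, one_pow, one_mul, mul_one]
    ring
  -- the derivative of `Φ ∘ c`
  have hΦc : (H.phiN hξ h φ ρ χb c₀ ε κ aR ε₄ ∘ RegularLevel.incl hγ) ∘ c =ᶠ[𝓝 0] g := by
    filter_upwards [hevall] with t ⟨hγ0, hg0⟩
    simp only [comp_apply, hcdef, dif_pos hγ0]
    exact hg0
  have hderiv : HasDerivAt ((H.phiN hξ h φ ρ χb c₀ ε κ aR ε₄ ∘ RegularLevel.incl hγ) ∘ c)
      (2 * (c₀ * (κ / η * β₀ * A - ε * u0 ^ 2 * (ρ A + A * deriv ρ A)) + ε₄ * (A * deriv χb A * u2))) 0 :=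
    hgd'.congr_of_eventuallyEq hΦc
  -- smoothness of `Φ_N` at `z`
  have hf₁ : a - η < f z.1 := by have := H.apply_eq hz.1; rw [hB] at this; linarith [H.A_nonneg j z.1]
  have hf₂ : f z.1 < a + 2 * η := by have := H.apply_eq hz.1; rw [hB] at this; linarith [H.A_nonneg j z.1]
  rw [← hc0]
  refine not_isMCriticalPt_of_hasDerivAt_comp₃ (hc.mdifferentiableAt (by simp)) ?_ hderiv (by
    intro h0; apply hd; linarith)
  rw [hc0]
  -- `Φ ∘ incl` is differentiable at `z`
  have hΦX := H.contMDiffAt_phiN_zone (hξ := hξ) (h := h) (φ := φ) (c₀ := c₀) (ε := ε) (κ := κ) (ε₄ := ε₄) hρs hχs hz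
  exact ((hΦX.comp z (RegularLevel.contMDiff_incl hγ z)).mdifferentiableAt (by simp))

/-- **(Z2) No critical point of `Φ_N` on the zone part of `N` where `χ_b(A_j) u₃ ≠ 0`** (the
derivative of `Φ` along the rotation curve is `-ε₄ χ_b(A_j) u₃`). [cite: GayKirby2016, §4, Lemma 14] -/
theorem not_isMCriticalPt_phiN_zone_of_u3_ne_zero (hρs : ContDiff ℝ ∞ ρ) (hχs : ContDiff ℝ ∞ χb)
    (hγ : IsRegularLevel (𝓡 4) (H.gapFn hξ h φ h₂ TP χlo χhi Spl Sbot Smin Psw) 0)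
    {j : ι} (z : RegularLevel hγ) (hz : z.1 ∈ H.zone aR j) (hB : H.B j z.1 = β₀)
    (hd : ε₄ * (χb (H.A j z.1) * (H.box j).coord z.1 3) ≠ 0) :
    ¬ IsMCriticalPt (𝓡 3) (H.phiN hξ h φ ρ χb c₀ ε κ aR ε₄ ∘ RegularLevel.incl hγ) z := by
  have hη := H.eta_pos
  set A := H.A j z.1 with hAdef
  set u0 := (H.box j).coord z.1 0 with hu0
  set u2 := (H.box j).coord z.1 2 with hu2
  set u3 := (H.box j).coord z.1 3 with hu3
  have hzA : A < aR := hz.2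
  have hA0 : 0 ≤ A := H.A_nonneg j z.1
  have hsmall : H.A j z.1 + H.B j z.1 < 3 * η := by rw [hB]; linarith
  have hev := H.rotCurve_eventually (j := j) hsmall
  set g : ℝ → ℝ := fun t => c₀ * (1 - ε * (u0 ^ 2 * ρ A) + κ / η * A * β₀) +
      ε₄ * (χb A * (Real.cos t * u2 - Real.sin t * u3)) with hg
  have hevall : ∀ᶠ t in 𝓝 (0 : ℝ), H.gapFn hξ h φ h₂ TP χlo χhi Spl Sbot Smin Psw (H.rotCurve j z.1 t) = 0 ∧
      H.phiN hξ h φ ρ χb c₀ ε κ aR ε₄ (H.rotCurve j z.1 t) = g t := by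
    filter_upwards [hev] with t ⟨hsrc, hcoord, hAt, hBt⟩
    have hAt' : H.A j (H.rotCurve j z.1 t) < aR := by rw [hAt]; exact hzA
    have hBt' : H.B j (H.rotCurve j z.1 t) = β₀ := by rw [hBt, hB]
    obtain ⟨hγ0, -, hθ, hβ⟩ := H.gapFn_eq_zero_of_B_eq (hξ := hξ) (h := h) (φ := φ) (h₂ := h₂) (TP := TP) (χlo := χlo)
      (χhi := χhi) (ρ := ρ) (χb := χb) (Spl := Spl) (Sbot := Sbot) (Smin := Smin) (Psw := Psw) (c₀ := c₀) (ε := ε)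
      (κ := κ) (aR := aR) hgl hfM hPsw hP₁ hTP₂ hh₂v hφv hTP₁ hβ₀ hβ₀η haRP haR hplateau hsrc hAt' hBt'
    refine ⟨hγ0, ?_⟩
    have hnsq : TubeModel.nsq (RadialThickening.proj ((H.box j).coord (H.rotCurve j z.1 t))) = A := by
      rw [← A_eq_nsq, hAt]
    have hbsq : RadialThickening.bsq ((H.box j).coord (H.rotCurve j z.1 t)) = β₀ := by rw [← B_eq_bsq, hBt']
    rw [HandleBoxes.phiN, hθ, hβ, TubeModel.tubeHat_apply, ChartZone.gmod_apply, hnsq, hbsq, RadialThickening.proj_apply_zero,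
      hAt, hcoord]
    simp only [vec4_apply_zero, vec4_apply_two, hg, hAdef, hu0, hu2, hu3]
  obtain ⟨hc, -⟩ := H.contMDiffAt_liftCurve hγ z (H.contMDiffAt_rotCurve hsmall) (hevall.mono fun t ht => ht.1)
  set c : ℝ → RegularLevel hγ := fun t =>
    if ht : H.gapFn hξ h φ h₂ TP χlo χhi Spl Sbot Smin Psw (H.rotCurve j z.1 t) = 0 then ⟨H.rotCurve j z.1 t, ht⟩ else z
    with hcdef
  have hc0 : c 0 = z := by
    have h0 : H.gapFn hξ h φ h₂ TP χlo χhi Spl Sbot Smin Psw (H.rotCurve j z.1 0) = 0 := by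
      rw [H.rotCurve_zero hz.1]; exact z.2
    apply (RegularLevel.isEmbedding_incl hγ).injective
    show (c 0).1 = z.1
    simp only [hcdef, dif_pos h0]
    exact H.rotCurve_zero hz.1
  -- the derivative of `g` at `0`
  have hcs : HasDerivAt (fun t => Real.cos t * u2 - Real.sin t * u3) (-Real.sin 0 * u2 - Real.cos 0 * u3) 0 :=
    ((Real.hasDerivAt_cos 0).mul_const u2).sub ((Real.hasDerivAt_sin 0).mul_const u3)
  have hgd : HasDerivAt g (-(ε₄ * (χb A * u3))) 0 := by
    have := ((hasDerivAt_const (0 : ℝ) (c₀ * (1 - ε * (u0 ^ 2 * ρ A) + κ / η * A * β₀))).add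
      ((hcs.const_mul (χb A)).const_mul ε₄))
    refine this.congr_deriv ?_
    simp only [Real.sin_zero, Real.cos_zero]
    ring
  have hΦc : (H.phiN hξ h φ ρ χb c₀ ε κ aR ε₄ ∘ RegularLevel.incl hγ) ∘ c =ᶠ[𝓝 0] g := by
    filter_upwards [hevall] with t ⟨hγ0, hg0⟩
    simp only [comp_apply, hcdef, dif_pos hγ0]
    exact hg0
  have hderiv : HasDerivAt ((H.phiN hξ h φ ρ χb c₀ ε κ aR ε₄ ∘ RegularLevel.incl hγ) ∘ c) (-(ε₄ * (χb A * u3))) 0 :=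
    hgd.congr_of_eventuallyEq hΦc
  rw [← hc0]
  refine not_isMCriticalPt_of_hasDerivAt_comp₃ (hc.mdifferentiableAt (by simp)) ?_ hderiv (neg_ne_zero.2 hd)
  rw [hc0]
  have hΦX := H.contMDiffAt_phiN_zone (hξ := hξ) (h := h) (φ := φ) (c₀ := c₀) (ε := ε) (κ := κ) (ε₄ := ε₄) hρs hχs hz
  exact ((hΦX.comp z (RegularLevel.contMDiff_incl hγ z)).mdifferentiableAt (by simp))

end Zone

end HandleBoxes

end Literature.Topology.FourManifolds

end
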